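import Literature.NumberTheory.Rogawski1990.LocalStableClassesNonsplitTypeOneCount   -- ★ B-p04: FILE 1 frame algebra (generic `n`), `exists_unitary_conj_iff_forall_exists_norm`, `cartanIndex`
import Literature.NumberTheory.Automorphic.LocalHermitianPlaneCongruence            -- ★ rank-2 Jacobowitz: `exists_formCongr_eq_of_det_eq_mul_norm`, `det_formCongr_eq_mul_norm`
import HarnessLib

/-!
# The LOCAL class set of a RANK-2 elliptic element at a non-split place: exactly TWO classes, read on ONE norm test
# (Rogawski 1990, §3.5 Prop. 3.5.2 (a)(c) p. 29 at `r = 2`; Flicker 1998, §6 p. 95: the two classes `t₁, t₂` of the `U(1,1)`-side)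

Topic `NumberTheory/Rogawski1990`; namespace `Literature.NumberTheory.Rogawski1990`.  **THEOREMS ONLY** (no definition, no named fact, no instance, no notation,
no `sorry`; count-neutral for the books).  Cell `pub/hodgecm-mathlib`, programme P3a, road «D-N7-inert» (inert unit fundamental lemma, books row #103-ns, COUNT from
[Flicker1998UnitaryFL]); sub-brick **(L5-e) «RANK-2 LOCAL CLASS SET»** of B-p10 (g24)'s (L5) «H-SIDE VALUE `Φ^st_{1_{K_H}}(t₀) = (q^N(q+1) − 2)∕(q − 1)`» (pre-census
`F0/P3a/B-p10/g24/PRECENSUS-L5-HsideValue.B-p10g24.md` §2 (v), §3; LEAD F0P3a-plan (g9) WORDS T8-33∕T8-35 (C)); consumer = (L5-d) `UnitStableOrbitalIntegralHSideCount`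
(the finsum `Φ^st = Σ_{classes}` over the TWO classes named here).  The RANK-2 TWIN of ★ B-p04 `LocalStableClassesNonsplit` §2 (rank-3 realisation) and ★
`LocalStableClassesNonsplitTypeOneCount` (four classes ↔ `(ε₁,ε₂,ε₃)`, `Σε = 0`): same frame algebra (★ FILE 1 §1 is generic in `n`), with the rank-2 Jacobowitz
classification ★ `UnitaryGroup.exists_formCongr_eq_of_det_eq_mul_norm` in place of the rank-3 one.  HONEST LABEL: HC_CM is proved only modulo the printed citations
until rung 0 closes; this file is unconditional local algebra.

THE PRINT.  [Rogawski1990, §3.5 Prop. 3.5.2 (c) p. 29]: for an anisotropic torus `T ≅ (E¹)^r`, `𝓔(T∕F) ≅ {(ε_j) ∈ (ℤ∕2)^r : Σ ε_j = 0}`, `|𝓡(T∕F)| = 2^{r−1}` — at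
`r = 2` (the torus `E¹ × E¹ ⊂ U(Φ₂) = U(1,1)`): TWO classes inside the local stable class of a regular elliptic `γ₂ ∈ U(H)(F_v)`, `H ∈ M₂(E_v)`, told apart by ONE
norm test on an eigenvector length.  [Flicker1998UnitaryFL, §6 p. 95]: «`Φ^st_{1_{K_H}}(t₀) = Φ_H(t₁) + Φ_H(t₂)`» — `t₁, t₂` are these two classes.

WHAT IS PROVED (`E_v = Π_{w∣v} E_w` = ★ `UnitaryGroup.LocalRing E v`, `σ = c ⊗ 1` = ★ `conjLocal`, `v` NON-SPLIT: `c • w = w`; `H ∈ M₂(E_v)` `σ`-hermitian with unit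
determinant; `γ ∈ U(H)(F_v)` with an EIGENFRAME `γ P = P · diag(u)`, `u₀ ≠ u₁`, `σ(uᵢ) uᵢ = 1`; norm test `T_i(g)` «`(H_{gP})ᵢᵢ = σ(z) z · (H_P)ᵢᵢ` for a unit `z`»,
spelled out, no definition):
* §1 RANK-2 LOCAL REALISATION: `exists_twistGram_eq_mul_iff_det_rankTwo` (a `⋆`-symmetric unit-determinant `x` is a Cartan class `H⁻¹H_g` iff `det x` is a norm),
  `exists_conj_mem_twistGram_eigenframe_eq_rankTwo` (every pair of `σ`-fixed unit frame ratios `(r₀, r₁)` with `r₀ r₁` a norm is realised by a stable conjugator).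
* §2 CRITERION AND PARITY: `exists_unitary_conj_iff_forall_normTest_iff_rankTwo` (classes ↔ the two norm tests), **`normTest_zero_iff_normTest_one_rankTwo`**
  (`T₀(g) ↔ T₁(g)`: `Π (H_{gP})ᵢᵢ = N(det g) Π (H_P)ᵢᵢ` + index two, via ★ `norm_test_zero_iff_one_iff_two` with a dummy third coordinate), `normTest_one_rankTwo`
  (`g = 1` passes), `exists_conj_mem_not_normTest_rankTwo` (the SECOND class: ratios `(r₀, r₀)`, `r₀` a non-norm unit), `exists_conj_mem_forall_normTest_iff_rankTwo`
  (every `ε ∈ (ℤ∕2)²` with `Σε = 0` is a class).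
* §3 THE COUNT: **`exists_conjClassesIn_eq_pair_rankTwo`** (`conjClassesIn = {⟦γ⟧, ⟦g₁ γ g₁⁻¹⟧}`, distinct — the shape (L5-d)'s `∑ᶠ` wants),
  **`ncard_conjClassesIn_eq_two_rankTwo`**, and the ELEMENT FORM **`exists_isStablyConj_not_isConj_forall_isConj_or_rankTwo`** («`∃ γ₂′` stably conjugate,
  not conjugate, every stably conjugate `δ` conjugate to `γ₂` or `γ₂′`»; finiteness of the class set follows from `ncard = 2`).  (Name note: `ncard_conjClassesIn_eq_two` is ★ B-p14's TYPE-(2)-torus count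
  in rank 3 — a different statement; hence the suffix `_rankTwo` throughout.)
NOT here: the unramified reading «norm test ⟺ even valuation» (Flicker's `v(α)` parity; rides as a rider on (L5-d)'s word over ★
`mem_quadraticNormSubgroup_iff_even_of_isUnramifiedIn`), the lattice count itself ((L5-a∕b∕c)).

## References
* [Rogawski1990] J. D. Rogawski, *Automorphic Representations of Unitary Groups in Three Variables*, Ann. of Math. Stud. 123 (1990), §3.1 p. 19, §3.3 Prop. 3.3.1
  p. 22, §3.5 Prop. 3.5.2 (a)(c) p. 29, §3.6 p. 31, §3.8 p. 33.
* [Flicker1998UnitaryFL] Y. Z. Flicker, *Elementary proof of the fundamental lemma for a unitary group*, Canad. J. Math. 50 (1998), §6 p. 95 (`t₁, t₂`).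
* [Kottwitz1986] R. E. Kottwitz, *Stable trace formula: elliptic singular terms*, Math. Ann. 275 (1986), §7.
* [Jacobowitz1962] R. Jacobowitz, *Hermitian forms over local fields*, Amer. J. Math. 84 (1962), §3 Thm. 3.1.
-/

set_option autoImplicit false

noncomputable section

open Matrix NumberField IsDedekindDomain
open scoped MatrixGroups

namespace Literature.NumberTheory.Rogawski1990

open Literature.NumberTheory.Automorphic Literature.NumberTheory.Automorphic.UnitaryGroup Literature.NumberTheory.QuadraticForms
open Literature.AlgebraicGeometry.ShimuraVarieties (unitaryGroup mem_unitaryGroup_iff)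

/-- `det (P · diag(d) · P⁻¹) = ∏ dᵢ`. [folklore] -/
private theorem det_eigenframe_diagonal {K : Type*} [Field K] {n : Type*} [Fintype n] [DecidableEq n] (P : GL n K) (d : n → K) :
    (P.val * diagonal d * (P⁻¹).val).det = ∏ i, d i := by
  rw [Matrix.det_mul, Matrix.det_mul, det_diagonal, mul_comm, ← mul_assoc, ← Matrix.det_mul, ← Units.val_mul, inv_mul_cancel, Units.val_one,
    Matrix.det_one, one_mul]

section RankTwo

variable {F : Type} (E : Type) [Field F] [NumberField F] [Field E] [NumberField E] [Algebra F E]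
  [Algebra.IsQuadraticExtension F E] (v : HeightOneSpectrum (𝓞 F)) (c : E ≃ₐ[F] E) {δ : E} (hcδ : c δ = -δ) (hδ : δ ≠ 0)

/-! ## §1 Rank-2 local realisation at a non-split place -/

include hcδ hδ in
/-- **A `⋆`-symmetric `x` is a Cartan class iff `det x` is a norm** (RANK 2, local coefficients, non-split `v`): for `H ∈ M₂(E_v)` `(c ⊗ 1)`-hermitian with unit
determinant and `x` with `x⋆ = x` (★ `hermStar`), `det x` a unit: `(∃ g ∈ GL₂(E_v), H_g = H · x) ↔ ∃ z ∈ E_vˣ, det x = σ(z) z` — the rank-2 Jacobowitz classification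
★ `exists_formCongr_eq_of_det_eq_mul_norm` ∕ ★ `det_formCongr_eq_mul_norm` (binary hermitian forms over `E_v ∕ F_v` are classified by `det` modulo norms).
[cite: Rogawski1990, §3.5 Prop. 3.5.2 (a) p. 29; §3.8 p. 33] [cite: Jacobowitz1962, §3 Thm. 3.1] -/
theorem exists_twistGram_eq_mul_iff_det_rankTwo (w : PlacesOver E v) (hw : c • w.1 = w.1)
    {H : Matrix (Fin 2) (Fin 2) (LocalRing E v)} (hH : (H.map (conjLocal E c v))ᵀ = H) (hHd : IsUnit H.det)
    {x : Matrix (Fin 2) (Fin 2) (LocalRing E v)} (hx : hermStar (conjLocal E c v) H x = x) (hxd : IsUnit x.det) :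
    (∃ g : GL (Fin 2) (LocalRing E v), twistGram (conjLocal E c v) H g.val = H * x) ↔
      ∃ z : LocalRing E v, IsUnit z ∧ x.det = conjLocal E c v z * z := by
  have hHx : ((H * x).map (conjLocal E c v))ᵀ = H * x := (conjTranspose_mul_eq_self_iff (conjLocal E c v) H hH hHd x).2 hx
  have hHxd : IsUnit (H * x).det := by rw [Matrix.det_mul]; exact hHd.mul hxd
  constructor
  · rintro ⟨g, hg⟩
    have hgd : IsUnit g.val.det := by
      have h := g.isUnit
      rwa [Matrix.isUnit_iff_isUnit_det] at h
    refine ⟨g.val.det, hgd, hHd.mul_left_cancel ?_⟩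
    have hd := congrArg Matrix.det hg
    rw [det_twistGram, Matrix.det_mul] at hd
    rw [← hd]
    ring
  · rintro ⟨z, hz, hzdet⟩
    obtain ⟨T, hT⟩ := exists_formCongr_eq_of_det_eq_mul_norm E v c hcδ hδ w hw hH hHx hHd hHxd ⟨z, hz, by rw [Matrix.det_mul, hzdet]⟩
    exact ⟨T, hT⟩

include hcδ hδ in
/-- **EVERY pair of `σ`-fixed unit frame ratios with norm product is REALISED (RANK 2, non-split `v`).**  `γ ∈ U(H)(F_v)` (`H ∈ M₂(E_v)` hermitian, unit
determinant) with eigenframe `γ P = P · diag(u)` (`u₀ ≠ u₁`, norm-one); for `r = (r₀, r₁)` with `σ(rᵢ) = rᵢ` units and `r₀ r₁ = σ(z) z`: there is a stable conjugator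
`g` (`g γ g⁻¹ ∈ U(H)(F_v)`) with eigenvector lengths `⟨g pᵢ, g pᵢ⟩_H = rᵢ · ⟨pᵢ, pᵢ⟩_H` (`x := P · diag(r) · P⁻¹ ∈ Z(γ)` is `⋆`-symmetric with norm determinant,
§1 realises `H · x = H_g`, and `H_{gP} = H_P · diag(r)`) — the surjectivity of the class set onto `{(r₀, r₁) ∈ (F_vˣ ∕ N)² : r₀ r₁ ∈ N} = 𝓔(T∕F_v)`, `r = 2`.
[cite: Rogawski1990, §3.5 Prop. 3.5.2 (a)(c) p. 29; §3.6 p. 31] [cite: Kottwitz1986, §7] -/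
theorem exists_conj_mem_twistGram_eigenframe_eq_rankTwo (w : PlacesOver E v) (hw : c • w.1 = w.1)
    {H : Matrix (Fin 2) (Fin 2) (LocalRing E v)} (hH : (H.map (conjLocal E c v))ᵀ = H) (hHd : IsUnit H.det)
    {γ : GL (Fin 2) (LocalRing E v)} (hγ : γ ∈ unitaryGroup (conjLocal E c v) H) {P : GL (Fin 2) (LocalRing E v)} {u : Fin 2 → LocalRing E v}
    (hP : γ.val * P.val = P.val * diagonal u) (hu : Function.Injective u) (hu1 : ∀ i, conjLocal E c v (u i) * u i = 1)
    (r : Fin 2 → LocalRing E v) (hσr : ∀ i, conjLocal E c v (r i) = r i) (hr : ∀ i, IsUnit (r i))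
    (hprod : ∃ z : LocalRing E v, IsUnit z ∧ ∏ i, r i = conjLocal E c v z * z) :
    ∃ g : GL (Fin 2) (LocalRing E v), g * γ * g⁻¹ ∈ unitaryGroup (conjLocal E c v) H ∧
      ∀ i, twistGram (conjLocal E c v) H (g.val * P.val) i i = r i * twistGram (conjLocal E c v) H P.val i i := by
  letI : Field (LocalRing E v) :=
    (Liu2021.LemD1IndexedNonVacuityNonsplitPlace.isField_localRing_of_nonsplit E v c hcδ hδ w hw).toField
  set x : Matrix (Fin 2) (Fin 2) (LocalRing E v) := P.val * diagonal r * (P⁻¹).val with hxdef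
  have hxγ : Commute x γ.val := commute_eigenframe_diagonal hP r
  have hx : hermStar (conjLocal E c v) H x = x :=
    (hermStar_eigenframe_diagonal_eq_self_iff (conjLocal E c v) H hHd.ne_zero hγ hP hu hu1 r).2 hσr
  have hxdet : x.det = ∏ i, r i := det_eigenframe_diagonal P r
  have hxd : IsUnit x.det := by
    rw [hxdet]
    exact Ne.isUnit (Finset.prod_ne_zero_iff.2 fun i _ => (hr i).ne_zero)
  have hdet : ∃ z : LocalRing E v, IsUnit z ∧ x.det = conjLocal E c v z * z := by
    obtain ⟨z, hz, h⟩ := hprod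
    exact ⟨z, hz, hxdet.trans h⟩
  obtain ⟨g, hg⟩ := (exists_twistGram_eq_mul_iff_det_rankTwo E v c hcδ hδ w hw hH hHd hx hxd).2 hdet
  refine ⟨g, conj_mem_unitaryGroup_of_twistGram_eq_mul (conjLocal E c v) H hγ hxγ hg, fun i => ?_⟩
  have hframe : twistGram (conjLocal E c v) H (g.val * P.val) = twistGram (conjLocal E c v) H P.val * diagonal r := by
    rw [twistGram_mul, hg, hxdef, twistGram_frame_mul_eigenframe_diagonal]
  rw [hframe, mul_diagonal, mul_comm]

/-! ## §2 The criterion in the frame and the parity of the two norm tests -/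

variable {H : Matrix (Fin 2) (Fin 2) (LocalRing E v)} {γ P : GL (Fin 2) (LocalRing E v)} {u : Fin 2 → LocalRing E v}

include hcδ hδ in
/-- **THE CLASSES ARE CLASSIFIED BY TWO NORM TESTS** (rank 2, non-split `v`): `g γ g⁻¹ ∼ g′ γ g′⁻¹` in `U(H)(F_v)` iff for each `i ∈ {0, 1}` the tests
«`⟨g′ pᵢ, g′ pᵢ⟩_H ∈ N · ⟨pᵢ, pᵢ⟩_H`» and «`⟨g pᵢ, g pᵢ⟩_H ∈ N · ⟨pᵢ, pᵢ⟩_H`» agree (★ generic criterion `exists_unitary_conj_iff_forall_exists_norm` + ★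
`exists_norm_mul_iff_norm_tests_iff`). [cite: Rogawski1990, §3.5 Prop. 3.5.2 (a)(c) p. 29] [cite: Kottwitz1986, §7] -/
theorem exists_unitary_conj_iff_forall_normTest_iff_rankTwo (w : PlacesOver E v) (hw : c • w.1 = w.1)
    (hH : (H.map (conjLocal E c v))ᵀ = H) (hHd : IsUnit H.det) (hγ : γ ∈ unitaryGroup (conjLocal E c v) H)
    (hP : γ.val * P.val = P.val * diagonal u) (hu : Function.Injective u) (hu1 : ∀ i, conjLocal E c v (u i) * u i = 1)
    {g g' : GL (Fin 2) (LocalRing E v)} (hg : g * γ * g⁻¹ ∈ unitaryGroup (conjLocal E c v) H)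
    (hg' : g' * γ * g'⁻¹ ∈ unitaryGroup (conjLocal E c v) H) :
    (∃ w' : GL (Fin 2) (LocalRing E v), w' ∈ unitaryGroup (conjLocal E c v) H ∧ w' * (g * γ * g⁻¹) * w'⁻¹ = g' * γ * g'⁻¹) ↔
      ∀ i, ((∃ z : LocalRing E v, IsUnit z ∧ twistGram (conjLocal E c v) H (g'.val * P.val) i i =
              conjLocal E c v z * z * twistGram (conjLocal E c v) H P.val i i) ↔
            (∃ z : LocalRing E v, IsUnit z ∧ twistGram (conjLocal E c v) H (g.val * P.val) i i =
              conjLocal E c v z * z * twistGram (conjLocal E c v) H P.val i i)) := by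
  letI : Field (LocalRing E v) :=
    (Liu2021.LemD1IndexedNonVacuityNonsplitPlace.isField_localRing_of_nonsplit E v c hcδ hδ w hw).toField
  have hσσ : ∀ s, conjLocal E c v (conjLocal E c v s) = s := Liu2021.LemD1OfPlace.conjLocal_conjLocal_apply E v c hcδ hδ
  rw [exists_unitary_conj_iff_forall_exists_norm (conjLocal E c v) H hHd.ne_zero hγ hP hu hu1 hg hg']
  refine forall_congr' fun i => ?_
  exact exists_norm_mul_iff_norm_tests_iff E v c hcδ hδ w hw
    (map_twistGram_apply_self (conjLocal E c v) H hσσ hH _ i)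
    (Ne.isUnit (twistGram_mul_eigenframe_apply_ne_zero (conjLocal E c v) H hHd.ne_zero hγ hP hu hu1 hg i))
    (map_twistGram_apply_self (conjLocal E c v) H hσσ hH _ i)
    (Ne.isUnit (twistGram_mul_eigenframe_apply_ne_zero (conjLocal E c v) H hHd.ne_zero hγ hP hu hu1 hg' i))
    (map_twistGram_apply_self (conjLocal E c v) H hσσ hH _ i)
    (Ne.isUnit (twistGram_eigenframe_apply_ne_zero (conjLocal E c v) H hHd.ne_zero hγ hP hu hu1 i))

include hcδ hδ in
/-- **THE TWO NORM TESTS AGREE** (rank 2, non-split `v`): for a stable conjugator `g`, test `0` passes iff test `1` passes — `(H_{gP})₀₀ (H_{gP})₁₁ =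
N(det g) · (H_P)₀₀ (H_P)₁₁` (★ FILE 1 `prod_twistGram_mul_eigenframe_eq`) and index two (★ `norm_test_zero_iff_one_iff_two`, read with a dummy third coordinate
`1`): the «`Σ ε_j = 0`» of [Prop. 3.5.2 (c)] at `r = 2`, `ε₀ = ε₁`. [cite: Rogawski1990, §3.5 Prop. 3.5.2 (c) p. 29] [cite: Omeara1963, §63B Prop. 63:13] -/
theorem normTest_zero_iff_normTest_one_rankTwo (w : PlacesOver E v) (hw : c • w.1 = w.1)
    (hH : (H.map (conjLocal E c v))ᵀ = H) (hHd : IsUnit H.det) (hγ : γ ∈ unitaryGroup (conjLocal E c v) H)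
    (hP : γ.val * P.val = P.val * diagonal u) (hu : Function.Injective u) (hu1 : ∀ i, conjLocal E c v (u i) * u i = 1)
    {g : GL (Fin 2) (LocalRing E v)} (hg : g * γ * g⁻¹ ∈ unitaryGroup (conjLocal E c v) H) :
    (∃ z : LocalRing E v, IsUnit z ∧ twistGram (conjLocal E c v) H (g.val * P.val) 0 0 =
        conjLocal E c v z * z * twistGram (conjLocal E c v) H P.val 0 0) ↔
      (∃ z : LocalRing E v, IsUnit z ∧ twistGram (conjLocal E c v) H (g.val * P.val) 1 1 =
        conjLocal E c v z * z * twistGram (conjLocal E c v) H P.val 1 1) := by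
  letI : Field (LocalRing E v) :=
    (Liu2021.LemD1IndexedNonVacuityNonsplitPlace.isField_localRing_of_nonsplit E v c hcδ hδ w hw).toField
  have hσσ : ∀ s, conjLocal E c v (conjLocal E c v s) = s := Liu2021.LemD1OfPlace.conjLocal_conjLocal_apply E v c hcδ hδ
  have hprod := prod_twistGram_mul_eigenframe_eq (conjLocal E c v) H hHd.ne_zero hγ hP hu hu1 hg
  simp only [Fin.prod_univ_two] at hprod
  have hgd : IsUnit g.val.det := by
    have h := g.isUnit
    rwa [Matrix.isUnit_iff_isUnit_det] at h
  -- the two eigenvector lengths and the two reference lengths, padded with a dummy third coordinate `1`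
  set a : Fin 3 → LocalRing E v :=
    ![twistGram (conjLocal E c v) H (g.val * P.val) 0 0, twistGram (conjLocal E c v) H (g.val * P.val) 1 1, 1] with ha
  set b : Fin 3 → LocalRing E v := ![twistGram (conjLocal E c v) H P.val 0 0, twistGram (conjLocal E c v) H P.val 1 1, 1] with hb
  have ha0 : a 0 = twistGram (conjLocal E c v) H (g.val * P.val) 0 0 := rfl
  have ha1 : a 1 = twistGram (conjLocal E c v) H (g.val * P.val) 1 1 := rfl
  have ha2 : a 2 = 1 := rfl
  have hb0 : b 0 = twistGram (conjLocal E c v) H P.val 0 0 := rfl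
  have hb1 : b 1 = twistGram (conjLocal E c v) H P.val 1 1 := rfl
  have hb2 : b 2 = 1 := rfl
  have haσ : ∀ i, conjLocal E c v (a i) = a i := by
    intro i
    fin_cases i
    · exact map_twistGram_apply_self (conjLocal E c v) H hσσ hH _ 0
    · exact map_twistGram_apply_self (conjLocal E c v) H hσσ hH _ 1
    · exact map_one _
  have hau : ∀ i, IsUnit (a i) := by
    intro i
    fin_cases i
    · exact Ne.isUnit (twistGram_mul_eigenframe_apply_ne_zero (conjLocal E c v) H hHd.ne_zero hγ hP hu hu1 hg 0)
    · exact Ne.isUnit (twistGram_mul_eigenframe_apply_ne_zero (conjLocal E c v) H hHd.ne_zero hγ hP hu hu1 hg 1)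
    · exact isUnit_one
  have hbσ : ∀ i, conjLocal E c v (b i) = b i := by
    intro i
    fin_cases i
    · exact map_twistGram_apply_self (conjLocal E c v) H hσσ hH _ 0
    · exact map_twistGram_apply_self (conjLocal E c v) H hσσ hH _ 1
    · exact map_one _
  have hbu : ∀ i, IsUnit (b i) := by
    intro i
    fin_cases i
    · exact Ne.isUnit (twistGram_eigenframe_apply_ne_zero (conjLocal E c v) H hHd.ne_zero hγ hP hu hu1 0)
    · exact Ne.isUnit (twistGram_eigenframe_apply_ne_zero (conjLocal E c v) H hHd.ne_zero hγ hP hu hu1 1)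
    · exact isUnit_one
  have hprod3 : ∃ z : LocalRing E v, IsUnit z ∧ a 0 * a 1 * a 2 = conjLocal E c v z * z * (b 0 * b 1 * b 2) :=
    ⟨g.val.det, hgd, by rw [ha0, ha1, ha2, hb0, hb1, hb2, mul_one, mul_one, hprod]⟩
  have key := norm_test_zero_iff_one_iff_two E v c hcδ hδ w hw haσ hau hbσ hbu hprod3
  rw [ha0, ha1, ha2, hb0, hb1, hb2] at key
  have htriv : ∃ z : LocalRing E v, IsUnit z ∧ (1 : LocalRing E v) = conjLocal E c v z * z * 1 :=
    ⟨1, isUnit_one, by rw [map_one, mul_one, mul_one]⟩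
  rw [key]
  exact ⟨fun h => h.2 htriv, fun h => ⟨fun _ => htriv, fun _ => h⟩⟩

omit [Algebra.IsQuadraticExtension F E] in
/-- The trivial conjugator passes every test (`z = 1`). [cite: Rogawski1990, §3.1 p. 19] -/
theorem normTest_one_rankTwo (i : Fin 2) :
    ∃ z : LocalRing E v, IsUnit z ∧ twistGram (conjLocal E c v) H ((1 : GL (Fin 2) (LocalRing E v)).val * P.val) i i =
      conjLocal E c v z * z * twistGram (conjLocal E c v) H P.val i i :=
  ⟨1, isUnit_one, by rw [Units.val_one, Matrix.one_mul, map_one, one_mul, one_mul]⟩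

include hcδ hδ in
/-- **THE SECOND CLASS EXISTS** (rank 2, non-split `v`): some stable conjugator `g` FAILS test `0` (hence test `1`) — realise the frame ratios `(r₀, r₀)` with `r₀` a
`σ`-fixed non-norm unit (★ `exists_conjLocal_eq_not_exists_norm`; `r₀² = σ(r₀) r₀` is a norm) by §1. [cite: Rogawski1990, §3.5 Prop. 3.5.2 (a)(c) p. 29] [cite: Kottwitz1986, §7] -/
theorem exists_conj_mem_not_normTest_rankTwo (w : PlacesOver E v) (hw : c • w.1 = w.1)
    (hH : (H.map (conjLocal E c v))ᵀ = H) (hHd : IsUnit H.det) (hγ : γ ∈ unitaryGroup (conjLocal E c v) H)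
    (hP : γ.val * P.val = P.val * diagonal u) (hu : Function.Injective u) (hu1 : ∀ i, conjLocal E c v (u i) * u i = 1) :
    ∃ g : GL (Fin 2) (LocalRing E v), g * γ * g⁻¹ ∈ unitaryGroup (conjLocal E c v) H ∧
      ¬ ∃ z : LocalRing E v, IsUnit z ∧ twistGram (conjLocal E c v) H (g.val * P.val) 0 0 =
        conjLocal E c v z * z * twistGram (conjLocal E c v) H P.val 0 0 := by
  letI : Field (LocalRing E v) :=
    (Liu2021.LemD1IndexedNonVacuityNonsplitPlace.isField_localRing_of_nonsplit E v c hcδ hδ w hw).toField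
  obtain ⟨r₀, hr₀σ, hr₀u, hr₀n⟩ := exists_conjLocal_eq_not_exists_norm E v c hcδ hδ w hw
  obtain ⟨g, hg, hframe⟩ := exists_conj_mem_twistGram_eigenframe_eq_rankTwo E v c hcδ hδ w hw hH hHd hγ hP hu hu1 (fun _ => r₀)
    (fun _ => hr₀σ) (fun _ => hr₀u) ⟨r₀, hr₀u, by rw [Fin.prod_univ_two, hr₀σ]⟩
  refine ⟨g, hg, fun ⟨z, hz, h⟩ => hr₀n ⟨z, hz, ?_⟩⟩
  have hne := twistGram_eigenframe_apply_ne_zero (conjLocal E c v) H hHd.ne_zero hγ hP hu hu1 (0 : Fin 2)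
  rw [hframe 0] at h
  exact mul_right_cancel₀ hne h

include hcδ hδ in
/-- **EVERY SUM-ZERO SIGN VECTOR IS A CLASS** (rank 2, non-split `v`): for `ε : Fin 2 → ℤ∕2` with `ε₀ + ε₁ = 0` (i.e. `ε₀ = ε₁`) some stable conjugator `g` has norm
tests reading `ε` (test `i` passes iff `εᵢ = 0`): `g = 1` for `ε = 0`, the second class for `ε = (1, 1)`. [cite: Rogawski1990, §3.5 Prop. 3.5.2 (a)(c) p. 29] -/
theorem exists_conj_mem_forall_normTest_iff_rankTwo (w : PlacesOver E v) (hw : c • w.1 = w.1)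
    (hH : (H.map (conjLocal E c v))ᵀ = H) (hHd : IsUnit H.det) (hγ : γ ∈ unitaryGroup (conjLocal E c v) H)
    (hP : γ.val * P.val = P.val * diagonal u) (hu : Function.Injective u) (hu1 : ∀ i, conjLocal E c v (u i) * u i = 1)
    (ε : Fin 2 → ZMod 2) (hε : ∑ i, ε i = 0) :
    ∃ g : GL (Fin 2) (LocalRing E v), g * γ * g⁻¹ ∈ unitaryGroup (conjLocal E c v) H ∧
      ∀ i, ((∃ z : LocalRing E v, IsUnit z ∧ twistGram (conjLocal E c v) H (g.val * P.val) i i =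
          conjLocal E c v z * z * twistGram (conjLocal E c v) H P.val i i) ↔ ε i = 0) := by
  have h01 : ∀ t : ZMod 2, t ≠ 0 → t = 1 := by decide
  rw [Fin.sum_univ_two] at hε
  have h1U : (1 : GL (Fin 2) (LocalRing E v)) * γ * 1⁻¹ ∈ unitaryGroup (conjLocal E c v) H := by
    rwa [one_mul, inv_one, mul_one]
  by_cases h0 : ε 0 = 0
  · have h1 : ε 1 = 0 := by rw [h0, zero_add] at hε; exact hε
    refine ⟨1, h1U, fun i => ?_⟩
    fin_cases i
    · exact iff_of_true (normTest_one_rankTwo E v c 0) h0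
    · exact iff_of_true (normTest_one_rankTwo E v c 1) h1
  · have h0' : ε 0 = 1 := h01 _ h0
    have h1' : ε 1 = 1 := by
      rw [h0'] at hε
      have : ε 1 ≠ 0 := fun h => by rw [h, add_zero] at hε; exact absurd hε (by decide)
      exact h01 _ this
    obtain ⟨g, hg, hT0⟩ := exists_conj_mem_not_normTest_rankTwo E v c hcδ hδ w hw hH hHd hγ hP hu hu1
    have hT1 : ¬ ∃ z : LocalRing E v, IsUnit z ∧ twistGram (conjLocal E c v) H (g.val * P.val) 1 1 =
        conjLocal E c v z * z * twistGram (conjLocal E c v) H P.val 1 1 :=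
      fun h => hT0 ((normTest_zero_iff_normTest_one_rankTwo E v c hcδ hδ w hw hH hHd hγ hP hu hu1 hg).2 h)
    refine ⟨g, hg, fun i => ?_⟩
    fin_cases i
    · exact iff_of_false hT0 h0
    · show _ ↔ ε 1 = 0
      exact iff_of_false hT1 fun h => absurd (h1'.symm.trans h) (by decide)

/-! ## §3 The count: the local stable class of a rank-2 elliptic element is the union of exactly TWO classes -/

include hcδ hδ in
/-- **THE LOCAL STABLE CLASS IS A PAIR OF CLASSES** (rank 2, non-split `v`): for `γ ∈ U(H)(F_v)` (`H ∈ M₂(E_v)` hermitian, unit determinant) with an eigenframe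
of two distinct norm-one eigenvalues there is a stable conjugator `g₁` failing the norm test, and `conjClassesIn = {⟦γ⟧, ⟦g₁ γ g₁⁻¹⟧}` with the two classes
DISTINCT — Flicker's `t₁, t₂`; the shape in which the `H`-side stable orbital integral `Φ^st = Σ_{classes} Φ` becomes a two-term sum.
[cite: Rogawski1990, §3.5 Prop. 3.5.2 (c) p. 29; §3.1 p. 19] [cite: Flicker1998UnitaryFL, §6 p. 95] -/
theorem exists_conjClassesIn_eq_pair_rankTwo (w : PlacesOver E v) (hw : c • w.1 = w.1)
    (hH : (H.map (conjLocal E c v))ᵀ = H) (hHd : IsUnit H.det) (hγ : γ ∈ unitaryGroup (conjLocal E c v) H)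
    (hP : γ.val * P.val = P.val * diagonal u) (hu : Function.Injective u) (hu1 : ∀ i, conjLocal E c v (u i) * u i = 1) :
    ∃ (g : GL (Fin 2) (LocalRing E v)) (hg : g * γ * g⁻¹ ∈ unitaryGroup (conjLocal E c v) H),
      (¬ ∃ z : LocalRing E v, IsUnit z ∧ twistGram (conjLocal E c v) H (g.val * P.val) 0 0 =
          conjLocal E c v z * z * twistGram (conjLocal E c v) H P.val 0 0) ∧
      conjClassesIn (conjLocal E c v) H ⟨γ, hγ⟩ =
          {ConjClasses.mk (⟨γ, hγ⟩ : unitaryGroup (conjLocal E c v) H), ConjClasses.mk ⟨g * γ * g⁻¹, hg⟩} ∧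
      ConjClasses.mk (⟨γ, hγ⟩ : unitaryGroup (conjLocal E c v) H) ≠ ConjClasses.mk ⟨g * γ * g⁻¹, hg⟩ := by
  classical
  set σ := conjLocal E c v with hσ
  set U := unitaryGroup σ H with hU
  set T : GL (Fin 2) (LocalRing E v) → Fin 2 → Prop := fun g i =>
    ∃ z : LocalRing E v, IsUnit z ∧ twistGram σ H (g.val * P.val) i i = σ z * z * twistGram σ H P.val i i with hT
  obtain ⟨g₁, hg₁, hT₁⟩ := exists_conj_mem_not_normTest_rankTwo E v c hcδ hδ w hw hH hHd hγ hP hu hu1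
  have h1U : (1 : GL (Fin 2) (LocalRing E v)) * γ * 1⁻¹ ∈ U := by rwa [one_mul, inv_one, mul_one]
  have hT1 : ∀ i, T 1 i := fun i => normTest_one_rankTwo E v c i
  have hpar : ∀ {g : GL (Fin 2) (LocalRing E v)}, g * γ * g⁻¹ ∈ U → (T g 0 ↔ T g 1) := fun hg =>
    normTest_zero_iff_normTest_one_rankTwo E v c hcδ hδ w hw hH hHd hγ hP hu hu1 hg
  have hT₁' : ¬ T g₁ 1 := fun h => hT₁ ((hpar hg₁).2 h)
  refine ⟨g₁, hg₁, hT₁, ?_, ?_⟩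
  · ext cl
    rw [Set.mem_insert_iff, Set.mem_singleton_iff]
    constructor
    · intro hcl
      obtain ⟨δ', rfl⟩ := ConjClasses.exists_rep cl
      obtain ⟨g, hg⟩ := isStablyConj_iff.1 (mk_mem_conjClassesIn_iff.1 hcl)
      have hgU : g * γ * g⁻¹ ∈ U := by rw [hg]; exact δ'.2
      by_cases hT0 : T g 0
      · left
        have hconj : ∃ w' : GL (Fin 2) (LocalRing E v), w' ∈ U ∧ w' * (1 * γ * 1⁻¹) * w'⁻¹ = g * γ * g⁻¹ := by
          rw [exists_unitary_conj_iff_forall_normTest_iff_rankTwo E v c hcδ hδ w hw hH hHd hγ hP hu hu1 h1U hgU]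
          intro i
          fin_cases i
          · exact iff_of_true hT0 (hT1 0)
          · exact iff_of_true ((hpar hgU).1 hT0) (hT1 1)
        obtain ⟨w', hw'U, hw'c⟩ := hconj
        rw [one_mul, inv_one, mul_one] at hw'c
        symm
        rw [ConjClasses.mk_eq_mk_iff_isConj, isConj_iff]
        refine ⟨⟨w', hw'U⟩, Subtype.ext ?_⟩
        show w' * γ * w'⁻¹ = δ'.val
        rw [hw'c, hg]
      · right
        have hT1g : ¬ T g 1 := fun h => hT0 ((hpar hgU).2 h)
        have hconj : ∃ w' : GL (Fin 2) (LocalRing E v), w' ∈ U ∧ w' * (g₁ * γ * g₁⁻¹) * w'⁻¹ = g * γ * g⁻¹ := by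
          rw [exists_unitary_conj_iff_forall_normTest_iff_rankTwo E v c hcδ hδ w hw hH hHd hγ hP hu hu1 hg₁ hgU]
          intro i
          fin_cases i
          · exact iff_of_false hT0 hT₁
          · exact iff_of_false hT1g hT₁'
        obtain ⟨w', hw'U, hw'c⟩ := hconj
        symm
        rw [ConjClasses.mk_eq_mk_iff_isConj, isConj_iff]
        refine ⟨⟨w', hw'U⟩, Subtype.ext ?_⟩
        show w' * (g₁ * γ * g₁⁻¹) * w'⁻¹ = δ'.val
        rw [hw'c, hg]
    · rintro (rfl | rfl)
      · exact mk_mem_conjClassesIn_iff.2 (IsStablyConj.refl _)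
      · exact mk_mem_conjClassesIn_iff.2 (isStablyConj_iff.2 ⟨g₁, rfl⟩)
  · intro heq
    rw [ConjClasses.mk_eq_mk_iff_isConj, isConj_iff] at heq
    obtain ⟨w', hw'⟩ := heq
    have hconj : ∃ w'' : GL (Fin 2) (LocalRing E v), w'' ∈ U ∧ w'' * (1 * γ * 1⁻¹) * w''⁻¹ = g₁ * γ * g₁⁻¹ :=
      ⟨w'.val, w'.2, by rw [one_mul, inv_one, mul_one]; exact congrArg Subtype.val hw'⟩
    rw [exists_unitary_conj_iff_forall_normTest_iff_rankTwo E v c hcδ hδ w hw hH hHd hγ hP hu hu1 h1U hg₁] at hconj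
    exact hT₁ ((hconj 0).2 (hT1 0))

include hcδ hδ in
/-- **THE LOCAL CLASS SET OF A RANK-2 ELLIPTIC ELEMENT HAS TWO ELEMENTS** (`|𝓡(T∕F_v)| = 2^{r−1}`, `r = 2`; non-split `v`). [cite: Rogawski1990, §3.5 Prop. 3.5.2 (c) p. 29]
[cite: Flicker1998UnitaryFL, §6 p. 95] -/
theorem ncard_conjClassesIn_eq_two_rankTwo (w : PlacesOver E v) (hw : c • w.1 = w.1)
    (hH : (H.map (conjLocal E c v))ᵀ = H) (hHd : IsUnit H.det) (hγ : γ ∈ unitaryGroup (conjLocal E c v) H)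
    (hP : γ.val * P.val = P.val * diagonal u) (hu : Function.Injective u) (hu1 : ∀ i, conjLocal E c v (u i) * u i = 1) :
    (conjClassesIn (conjLocal E c v) H ⟨γ, hγ⟩).ncard = 2 := by
  obtain ⟨g, hg, -, hpair, hne⟩ := exists_conjClassesIn_eq_pair_rankTwo E v c hcδ hδ w hw hH hHd hγ hP hu hu1
  rw [hpair, Set.ncard_pair hne]

include hcδ hδ in
/-- **ELEMENT FORM (the shape (L5-d) reads): `∃ γ₂′ ∈ U(H)(F_v)` stably conjugate and NOT conjugate to `γ₂`, such that every `δ ∈ U(H)(F_v)` stably conjugate to `γ₂` is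
conjugate to `γ₂` or to `γ₂′`** — `γ₂′ = g₁ γ₂ g₁⁻¹` for the stable conjugator `g₁` failing the norm test (§2); Flicker's `t₁ = γ₂`, `t₂ = γ₂′`.
[cite: Rogawski1990, §3.5 Prop. 3.5.2 (c) p. 29; §3.1 p. 19] [cite: Flicker1998UnitaryFL, §6 p. 95] -/
theorem exists_isStablyConj_not_isConj_forall_isConj_or_rankTwo (w : PlacesOver E v) (hw : c • w.1 = w.1)
    (hH : (H.map (conjLocal E c v))ᵀ = H) (hHd : IsUnit H.det) (hγ : γ ∈ unitaryGroup (conjLocal E c v) H)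
    (hP : γ.val * P.val = P.val * diagonal u) (hu : Function.Injective u) (hu1 : ∀ i, conjLocal E c v (u i) * u i = 1) :
    ∃ (g : GL (Fin 2) (LocalRing E v)) (hg : g * γ * g⁻¹ ∈ unitaryGroup (conjLocal E c v) H),
      (¬ ∃ z : LocalRing E v, IsUnit z ∧ twistGram (conjLocal E c v) H (g.val * P.val) 0 0 =
          conjLocal E c v z * z * twistGram (conjLocal E c v) H P.val 0 0) ∧
      IsStablyConj (conjLocal E c v) H ⟨γ, hγ⟩ ⟨g * γ * g⁻¹, hg⟩ ∧
      ¬ IsConj (⟨γ, hγ⟩ : unitaryGroup (conjLocal E c v) H) ⟨g * γ * g⁻¹, hg⟩ ∧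
      ∀ δ' : unitaryGroup (conjLocal E c v) H, IsStablyConj (conjLocal E c v) H ⟨γ, hγ⟩ δ' →
        IsConj (⟨γ, hγ⟩ : unitaryGroup (conjLocal E c v) H) δ' ∨ IsConj (⟨g * γ * g⁻¹, hg⟩ : unitaryGroup (conjLocal E c v) H) δ' := by
  obtain ⟨g, hg, hT, hpair, hne⟩ := exists_conjClassesIn_eq_pair_rankTwo E v c hcδ hδ w hw hH hHd hγ hP hu hu1
  refine ⟨g, hg, hT, isStablyConj_iff.2 ⟨g, rfl⟩, fun h => hne (ConjClasses.mk_eq_mk_iff_isConj.2 h), fun δ' hst => ?_⟩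
  have hmem : ConjClasses.mk δ' ∈ conjClassesIn (conjLocal E c v) H ⟨γ, hγ⟩ := mk_mem_conjClassesIn_iff.2 hst
  rw [hpair, Set.mem_insert_iff, Set.mem_singleton_iff] at hmem
  rcases hmem with h | h
  · exact Or.inl (ConjClasses.mk_eq_mk_iff_isConj.1 h.symm)
  · exact Or.inr (ConjClasses.mk_eq_mk_iff_isConj.1 h.symm)

end RankTwo

end Literature.NumberTheory.Rogawski1990

end
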